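import Summits.ValiantsHypothesis.ValiantsHypothesis.Theorems.MonotoneRestorationOrbitRestorationQPTermCircuitSymmetry
import Summits.ValiantsHypothesis.ValiantsHypothesis.Theorems.MonotoneRestorationOrbitRestorationQPTermCircuitReduced
import Literature.Computability.AlgebraicComplexity.DawarWilsenach2025
import HarnessLib

/-!
# The reduced term circuit: semantics and the LENGTH-FREE orbit bound

Route MonotoneRestoration, crux `OrbitRestorationQP` (stmt-ValiantsHypothesis-18293) — K3 machinery, namespace
`Summit.ValiantsHypothesis.ValiantsHypothesis.Theorems.TermCircuit`.

* `eval_eq_gval` / `eval_output` — the reduced term circuit computes, at the gate of a term, the value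
  `HTerm.val` of the term (a sum node over the children set `{u : count 1} ∪ {Sc (count u) u}` recovers
  `Σ count(u) · u`, `Finset.sum_list_map_count`; a square `u · u` is wired as `{u, Sc 1 u}`);
* `ncard_range_perm_le` — the DESIGNED orbit of every gate is bounded by a common bound `B` on the
  `Γ`-orbits of the variables and of the member terms;
* `exists_symmetric_orbitSize_le` — **packaged**: a `Γ`-stable closed universe of normal terms with
  `Γ`-fixed root (characteristic `0`, finitely many variables, `Γ` finite) has a `Γ`-symmetric labelled
  arithmetic circuit computing the root's value whose Dawar–Wilsenach orbit size (`ORB`, over ALL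
  automorphisms, §3.3) is `≤ B` — independently of the number of terms, because the circuit is reduced,
  hence rigid (`Literature/…/SymmetricCircuitRigidity.lean`).

Everything is proved. [folklore]

## References
* A. Dawar, G. Wilsenach, *Symmetric arithmetic circuits*, ToC 21 (2025), Defs. 2.2, 3.6, 3.7, §3.3
  (`Orb`, `ORB`). [DawarWilsenach2025]
* A. Dawar, G. Wilsenach, *Symmetric circuits for rank logic*, ACM ToCL 23 (2021/22), §3 (syntactic
  equivalence, reduced circuits, unique extensions). [DawarWilsenach2021]
* A. Dawar, B. Pago, T. Seppelt, *Symmetric algebraic circuits and homomorphism polynomials*,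
  arXiv:2502.06740 (2025), §5. [DawarPagoSeppelt2025]
-/

noncomputable section

open scoped Classical

-- `Summit.ValiantsHypothesis.ValiantsHypothesis.…` is the tree's single-conjunct layout (Sub = Summit).
set_option linter.dupNamespace false

namespace Summit.ValiantsHypothesis.ValiantsHypothesis.Theorems

open Literature.Computability.AlgebraicComplexity

namespace TermCircuit

open HTerm

universe u v

variable {K : Type u} {X : Type v} [CommSemiring K] (𝒰 : Universe K X)

/-! ### The circuit computes the values of the terms -/

/-- The intended value of a gate. [folklore] -/
def gval : Gate 𝒰 → MvPolynomial X K
  | Gate.V x => MvPolynomial.X x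
  | Gate.C c => MvPolynomial.C c.1
  | Gate.T t => t.1.val
  | Gate.Sc m u => MvPolynomial.C ((m : ℕ) : K) * u.1.val
  | Gate.Pl u => u.1.val
  | Gate.Zr => 0

/-- The intended value of the gate of a member is the value of the member. [folklore] -/
theorem gval_gateOf {u : HTerm K X} (hu : u ∈ 𝒰.T) : gval 𝒰 (gateOf 𝒰 u) = u.val := by
  cases u with
  | var x => simp [gateOf, gval]
  | const c => rw [gateOf_const 𝒰 hu]; simp [gval]
  | node b l => rw [gateOf_node 𝒰 hu]; rfl

/-- The intended value of a representative: `m · u`. [folklore] -/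
theorem gval_rep {u : HTerm K X} (hu : u ∈ 𝒰.T) {m : ℕ} (hmM : m ≤ 𝒰.M) :
    gval 𝒰 (rep 𝒰 u m) = MvPolynomial.C (m : K) * u.val := by
  by_cases h1 : m = 1
  · subst h1; rw [rep_one, gval_gateOf 𝒰 hu]; simp
  · rw [rep_of_ne_one 𝒰 hu h1 hmM]; rfl

/-- **The reduced term circuit computes, at every gate, its intended value** (in particular the node
gate of a term `t` computes `t.val`). [folklore] -/
theorem eval_eq_gval [CharZero K] (g : Gate 𝒰) : (circuit 𝒰).eval g = gval 𝒰 g := by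
  induction g using (circuit 𝒰).wf.induction with
  | h g ih =>
    change ∀ h, h ∈ children 𝒰 g → (circuit 𝒰).eval h = gval 𝒰 h at ih
    cases g with
    | V x => exact (circuit 𝒰).eval_of_label_var (g := Gate.V x) rfl
    | C c => exact (circuit 𝒰).eval_of_label_const (g := Gate.C c) rfl
    | Zr =>
      rw [(circuit 𝒰).eval_of_label_mul (g := Gate.Zr) rfl]
      change ∏ h ∈ children 𝒰 Gate.Zr, _ = _
      have hch : children 𝒰 Gate.Zr =
          {Gate.C ⟨((0 : ℕ) : K), natCast_mem_consts 𝒰 (Nat.zero_le _)⟩} := rfl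
      rw [hch, Finset.prod_singleton, ih _ (by rw [hch]; simp)]
      simp [gval]
    | Pl u =>
      rw [(circuit 𝒰).eval_of_label_add (g := Gate.Pl u) rfl]
      change ∑ h ∈ children 𝒰 (Gate.Pl u), _ = _
      have hch : children 𝒰 (Gate.Pl u) = {gateOf 𝒰 u.1, Gate.Zr} := rfl
      rw [hch, Finset.sum_pair (gateOf_ne_Zr 𝒰 u.2), ih _ (by rw [hch]; simp),
        ih _ (by rw [hch]; simp), gval_gateOf 𝒰 u.2]
      simp [gval]
    | Sc m u =>
      rw [(circuit 𝒰).eval_of_label_mul (g := Gate.Sc m u) rfl]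
      change ∏ h ∈ children 𝒰 (Gate.Sc m u), _ = _
      have hch : children 𝒰 (Gate.Sc m u) =
          {Gate.C ⟨((m : ℕ) : K), natCast_mem_consts 𝒰 (Nat.le_of_lt_succ m.2)⟩, Gate.Pl u} := rfl
      rw [hch, Finset.prod_pair (by simp), ih _ (by rw [hch]; simp), ih _ (by rw [hch]; simp)]
      simp [gval]
    | T t =>
      obtain ⟨t, ht⟩ := t
      obtain ⟨b, l, rfl⟩ := exists_eq_node_of_mem_nodes 𝒰 ht
      have hT := mem_T_of_mem_nodes 𝒰 ht
      cases b with
      | false =>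
        rw [(circuit 𝒰).eval_of_label_add (g := Gate.T ⟨node false l, ht⟩) (label_T_sum 𝒰 ⟨_, ht⟩ l rfl)]
        change ∑ h ∈ children 𝒰 (Gate.T ⟨node false l, ht⟩), _ = _
        have hch := children_T_sum 𝒰 ⟨_, ht⟩ l rfl
        rw [hch, toFinset_map_gate, Finset.sum_image]
        · simp only [gval, val_node_false]
          rw [Finset.sum_list_map_count]
          refine Finset.sum_congr rfl fun u hu => ?_
          have hu' : u ∈ l := List.mem_toFinset.1 hu
          have huT : u ∈ 𝒰.T := 𝒰.closed _ _ hT u hu'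
          rw [ih _ (by rw [hch, List.mem_toFinset, List.mem_map]; exact ⟨u, hu', rfl⟩),
            gval_rep 𝒰 huT (𝒰.count_le l hT u), nsmul_eq_mul, map_natCast]
        · intro u hu u' hu' h
          exact (rep_inj 𝒰 (𝒰.closed _ _ hT u (List.mem_toFinset.1 hu))
            (𝒰.closed _ _ hT u' (List.mem_toFinset.1 hu'))
            (List.count_pos_iff.2 (List.mem_toFinset.1 hu)) (𝒰.count_le l hT u)
            (List.count_pos_iff.2 (List.mem_toFinset.1 hu')) (𝒰.count_le l hT u') h).1
      | true =>
        rw [(circuit 𝒰).eval_of_label_mul (g := Gate.T ⟨node true l, ht⟩) (label_T_prod 𝒰 ⟨_, ht⟩ l rfl)]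
        change ∏ h ∈ children 𝒰 (Gate.T ⟨node true l, ht⟩), _ = _
        obtain ⟨a, c, rfl⟩ := List.length_eq_two.1 (𝒰.binary l hT)
        have ha : a ∈ 𝒰.T := 𝒰.closed _ _ hT a (by simp)
        have hc : c ∈ 𝒰.T := 𝒰.closed _ _ hT c (by simp)
        simp only [gval, val_node_true, List.map_cons, List.map_nil, List.prod_cons, List.prod_nil,
          mul_one]
        by_cases hac : a = c
        · subst hac
          have hch := children_T_sq 𝒰 ⟨_, ht⟩ a rfl ha
          rw [hch, Finset.prod_pair (gateOf_ne_Sc 𝒰 ha _ _), ih _ (by rw [hch]; simp),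
            ih _ (by rw [hch]; simp), gval_gateOf 𝒰 ha]
          simp [gval]
        · have hch := children_T_pair 𝒰 ⟨_, ht⟩ a c rfl hac
          have hne : gateOf 𝒰 a ≠ gateOf 𝒰 c := fun h => hac (gateOf_injOn 𝒰 ha hc h)
          rw [hch, Finset.prod_pair hne, ih _ (by rw [hch]; simp), ih _ (by rw [hch]; simp),
            gval_gateOf 𝒰 ha, gval_gateOf 𝒰 hc]

/-- **The output computes the value of the root term.** [folklore] -/
theorem eval_output [CharZero K] : (circuit 𝒰).eval ((circuit 𝒰).output ()) = 𝒰.root.val := by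
  change (circuit 𝒰).eval (gateOf 𝒰 𝒰.root) = _
  rw [eval_eq_gval, gval_gateOf 𝒰 𝒰.root_mem]

end TermCircuit

end Summit.ValiantsHypothesis.ValiantsHypothesis.Theorems

namespace Summit.ValiantsHypothesis.ValiantsHypothesis.Theorems

open Literature.Computability.AlgebraicComplexity

namespace TermCircuit

open HTerm

universe u v

variable {K : Type u} {X : Type v} [CommSemiring K] (𝒰 : Universe K X)
variable {Γ : Type*} [Group Γ] [MulAction Γ X]

/-! ### Orbit bound and the packaged theorem -/

/-- A range through a factorisation is no larger than the range of the factor. [folklore] -/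
theorem ncard_range_le_of_factor {α β γ : Type*} [Finite α] (f : α → γ) (h : α → β) (F : β → γ)
    (hf : ∀ a, f a = F (h a)) : (Set.range f).ncard ≤ (Set.range h).ncard := by
  have : Set.range f ⊆ F '' Set.range h := by
    rintro _ ⟨a, rfl⟩
    exact ⟨h a, ⟨a, rfl⟩, (hf a).symm⟩
  exact (Set.ncard_le_ncard this ((Set.finite_range h).image F)).trans
    (Set.ncard_image_le (Set.finite_range h))

/-- **Designed orbits are bounded** by the orbits of variables and of member terms. [folklore] -/
theorem ncard_range_perm_le [Finite Γ] (hS : ∀ (γ : Γ) (t : HTerm K X), t ∈ 𝒰.T → act γ t ∈ 𝒰.T) (B : ℕ) (hB : 1 ≤ B)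
    (hX : ∀ x : X, (Set.range fun γ : Γ => γ • x).ncard ≤ B)
    (hT : ∀ t ∈ 𝒰.T, (Set.range fun γ : Γ => act γ t).ncard ≤ B) (g : Gate 𝒰) :
    (Set.range fun γ : Γ => perm 𝒰 hS γ g).ncard ≤ B := by
  cases g with
  | V x =>
    exact (ncard_range_le_of_factor _ (fun γ : Γ => γ • x) Gate.V fun _ => rfl).trans (hX x)
  | C c =>
    refine le_trans ?_ hB
    rw [show (Set.range fun γ : Γ => perm 𝒰 hS γ (Gate.C c)) = {Gate.C c} from ?_]
    · rw [Set.ncard_singleton]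
    · ext g
      simp only [Set.mem_range, Set.mem_singleton_iff]
      exact ⟨fun ⟨_, h⟩ => h ▸ rfl, fun h => ⟨1, by rw [h]; rfl⟩⟩
  | T t =>
    have ht : t.1 ∈ 𝒰.T := mem_T_of_mem_nodes 𝒰 t.2
    refine (ncard_range_le_of_factor _ (fun γ : Γ => act γ t.1) (gateOf 𝒰) fun γ => ?_).trans
      (hT _ ht)
    obtain ⟨t, ht'⟩ := t
    obtain ⟨b, l, rfl⟩ := exists_eq_node_of_mem_nodes 𝒰 ht'
    rw [← gateOf_node 𝒰 ht, perm_gateOf 𝒰 hS γ ht]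
  | Sc m u =>
    refine (ncard_range_le_of_factor _ (fun γ : Γ => act γ u.1)
      (fun s => if h : s ∈ 𝒰.T then Gate.Sc m ⟨s, h⟩ else Gate.Zr) fun γ => ?_).trans (hT _ u.2)
    simp only [dif_pos (hS γ u.1 u.2)]
    rfl
  | Pl u =>
    refine (ncard_range_le_of_factor _ (fun γ : Γ => act γ u.1)
      (fun s => if h : s ∈ 𝒰.T then Gate.Pl ⟨s, h⟩ else Gate.Zr) fun γ => ?_).trans (hT _ u.2)
    simp only [dif_pos (hS γ u.1 u.2)]
    rfl
  | Zr =>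
    refine le_trans ?_ hB
    rw [show (Set.range fun γ : Γ => perm 𝒰 hS γ Gate.Zr) = {Gate.Zr} from ?_]
    · rw [Set.ncard_singleton]
    · ext g
      simp only [Set.mem_range, Set.mem_singleton_iff]
      exact ⟨fun ⟨_, h⟩ => h ▸ rfl, fun h => ⟨1, by rw [h]; rfl⟩⟩

/-- **The reduced term circuit of a universe (packaged).** For a `Γ`-stable closed universe of normal
terms with `Γ`-fixed root (constants of characteristic `0`, finitely many variables, `Γ` finite): a
`Γ`-symmetric labelled arithmetic circuit computing the value of the root, all of whose Dawar–Wilsenach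
orbits (over ALL automorphisms) are bounded by a common bound `B` on the `Γ`-orbits of the variables
and of the member terms — INDEPENDENTLY of the number of terms. [folklore] -/
theorem exists_symmetric_orbitSize_le [Fintype X] [CharZero K] [Finite Γ] [MulAction Γ Unit]
    (hS : ∀ (γ : Γ) (t : HTerm K X), t ∈ 𝒰.T → act γ t ∈ 𝒰.T) (hroot : ∀ γ : Γ, act γ 𝒰.root = 𝒰.root) (B : ℕ) (hB : 1 ≤ B)
    (hX : ∀ x : X, (Set.range fun γ : Γ => γ • x).ncard ≤ B)
    (hT : ∀ t ∈ 𝒰.T, (Set.range fun γ : Γ => act γ t).ncard ≤ B) :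
    ∃ (G : Type (max u v)) (_ : Fintype G) (C : LabelledArithCircuit K X Unit G),
      C.IsSymmetric Γ ∧ C.eval (C.output ()) = 𝒰.root.val ∧ C.orbitSize Γ ≤ B :=
  ⟨Gate 𝒰, inferInstance, circuit 𝒰, circuit_isSymmetric 𝒰 hS hroot, eval_output 𝒰,
    (circuit_isReduced 𝒰).orbitSize_le (perm 𝒰 hS) (perm_isAutomorphismExtending 𝒰 hS hroot)
      (ncard_range_perm_le 𝒰 hS B hB hX hT)⟩

end TermCircuit

end Summit.ValiantsHypothesis.ValiantsHypothesis.Theorems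

end
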